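import Summits.Ventures.Crystal3D.Theorems.StickyWulffConstantGenericWallFloorBarlowRowCovGlueApart
import Summits.Ventures.Crystal3D.Theorems.StickyWulffConstantGenericWallFloorStarFarHolds
import Summits.Ventures.Crystal3D.Theorems.StickyWulffConstantGenericWallFloorOfP5Exhaustion
import HarnessLib

/-!
# TexShadow v6.14 → v6.15: the ROW-COVERED generic wall part at the key of record `OffR := FramesApart`, MODULO E1 ONLY
# (lane T, crux `TextureLiminf`, stmt-Ventures-19483; registered line `TexShadow`; closes `stub_bilayerWallRowCov` up to `stub_E1`)

HONEST FRAMING. Venture `Summits/Ventures/Crystal3D` (cell `crystal3d-full`), helper `--supports` the crux `TextureLiminf`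
(stmt-Ventures-19483) of `route-Ventures-StickyWulffConstant`, registered line `TexShadow`.  Rung credit only; F-C1 not moved.

* **`rowCov_apart : P5Exhaustion → ∃ R, BilayerWallRowCovFrom FramesApart R`** and the thresholded form
  **`rowCov_apart' : P5Exhaustion → ∃ R, 1 ≤ R ∧ BilayerWallRowCovFrom FramesApart R`** (`R = 6`): lane G's FramesApart row-corner chain
  (19480-p2 g8, option (C): `…BarlowStarRigidity` p664613, `…BarlowCoreAvoid` p664959, `…WalkerFamilyLedgerSep` p664810, the `…Apart`
  re-assembly, capstone `barlow_rowhlines_apart` + T-side closer `exists_bilayerWallRowCovFrom_framesApart`, p670788 ✓) with its two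
  `StarPairFar` inputs DISCHARGED by the tree theorem `StarFar.starPairFar_holds` (wulff-p2 g12, p636422 ✓) and E1 (`P5Exhaustion`, certified
  outside the kernel: cf-p2 R38 / eng R39c) carried as the one hypothesis — exactly the inputs of the closed walker-covered stub.
So the skeleton's `stub_bilayerWallRowCov : ∃ R, BilayerWallRowCovFrom FramesApart R` is `rowCov_apart stub_E1` (one line, v6.15).
GRADE: COMPUTATIONAL (compiled `native_decide` evaluations `StarFar.tasks*_ok`, `allCertOK_ok`, `tasks_cover` behind `starPairFar_holds`);
the hypothesis-carrying standard-axioms form is 19480-p2's `exists_bilayerWallRowCovFrom_framesApart hsE hcert hDS hCP`.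
WHAT THIS IS NOT: E1 is not discharged; nothing about onReachAll / deficit-min / residual; F-C1 not moved.
-/

noncomputable section

namespace Summit.Ventures.Crystal3D.Cruxes.TextureLiminf.TexShadow

open Summit.Ventures.Crystal3D Summit.Ventures.Crystal3D.Theorems

/-- **Row-covered generic walls at `OffR := FramesApart`, modulo E1**: `P5Exhaustion → ∃ R, BilayerWallRowCovFrom FramesApart R`
(the statement of the skeleton's `stub_bilayerWallRowCov` with `stub_E1` as the hypothesis). -/
theorem rowCov_apart (hE1 : P5Exhaustion) : ∃ R : ℝ, BilayerWallRowCovFrom FramesApart R := by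
  obtain ⟨sE, hsE, hcert⟩ := exactOnly_star_of_p5Exhaustion hE1
  exact exists_bilayerWallRowCovFrom_framesApart hsE hcert
    (doubleStarCoaxialAt_of_starPairFar StarFar.starPairFar_holds) (capPairCoaxial_of_starPairFar StarFar.starPairFar_holds)

/-- The same with the threshold made explicit (`R = 6 ≥ 1`), in the shape of the other `…From` parts. -/
theorem rowCov_apart' (hE1 : P5Exhaustion) : ∃ R : ℝ, 1 ≤ R ∧ BilayerWallRowCovFrom FramesApart R := by
  obtain ⟨sE, hsE, hcert⟩ := exactOnly_star_of_p5Exhaustion hE1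
  exact ⟨6, by norm_num, bilayerWallRowCovFrom_framesApart hsE hcert
    (doubleStarCoaxialAt_of_starPairFar StarFar.starPairFar_holds) (capPairCoaxial_of_starPairFar StarFar.starPairFar_holds)⟩

end Summit.Ventures.Crystal3D.Cruxes.TextureLiminf.TexShadow

end
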